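import Summits.BirchSwinnertonDyer.BirchSwinnertonDyer.Theorems.GenusKolyvaginAtTwoPowDvdShaCardAtTwoRTKummerExactReal
import Summits.BirchSwinnertonDyer.BirchSwinnertonDyer.Theorems.GenusKolyvaginAtTwoPowDvdShaCardAtTwoRTAuxiliaryClass
import Summits.BirchSwinnertonDyer.BirchSwinnertonDyer.Theorems.GenusKolyvaginAtTwoKramerParityBridgeLocal
import HarnessLib

/-!
# Route `GenusKolyvaginAtTwo`, LINES 18/19 (L_T stmt-BirchSwinnertonDyer-23242, L⁺_T stmt-23379), step (b) input I5, all places: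
# McCALLUM'S MAXIMAL-ISOTROPIC COUNT OVER A SET OF PLACES OF ANY KIND (finite, real, complex) of ANY number field

Width seat `bsd-line-gk2-p4` g16 (cell `bsd-f1-sign2`), `--supports stmt-BirchSwinnertonDyer-23242` (helper; closes nothing).
THEOREMS ONLY: no definition, no named fact, no `sorry`; standard axioms.  BSD is NOT proved by any of this.
Sequel of `…RTKummerExactReal.lean` / `…RTAuxiliaryClassReal.lean` (real places in the Kummer part, finite places in `T`).

WHY.  gk2-p2's named fact `McCallum1991_prop_2_1_auxiliaryClass K` (p687525) quantifies `w` and `S` over ALL places of ANY number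
field.  Parts 1–9 of this series cover `T = S ∪ {w}` made of finite places.  To reach the fact's full prime-power case the count
`#loc_T(H¹_{𝓛, ⊤ on T})² = ∏_{v∈T} #H¹(K_v, E[p^k])` is redone here for `T : Finset (Place K)`: at a real place the local Weil
cup-product pairing is perfect (`invWeilPairing_bijective_inl`, left kernel `eq_zero_of_forall_weilCupProduct_eq_zero_inl`), at a
complex place `H¹ = 0` and everything is trivial (`invWeilPairing_bijective_inl_of_isComplex`).

WHAT (namespace `…Theorems.GenusExact.AuxiliaryClass`; `T : Finset (Place K)`, `loc`/`bP` characterised by `hloc`/`hbP`):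
`invWeilPairing_bijective_inl(_of_isComplex)`, `invWeilPairing_bijective_place` (finiteness at every place is gk2-p4 g11's
`GenusKolyKramer.finite_galoisCohomology_toLocal`, reused),
**`annLeft_map_kummerOutside_eq_places`**, **`natCard_map_kummerOutside_sq_places`** (`#G² = ∏_{v∈T} #H¹(K_v, E[p^k])`).

References: [McCallumLMS1991] §2 Prop. 2.1 (proof); [MilneADT2006] Ch. I Cor. 2.3, Thm. 2.13, Thm. 4.10(b).
-/

set_option autoImplicit false
-- the Theorems namespace of this sub repeats the summit name by design (D-0017 nested layout)
set_option linter.dupNamespace false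

noncomputable section

open scoped Classical

open CategoryTheory Field NumberField IsDedekindDomain Function
open Literature.NumberTheory.EllipticCurves
open Literature.NumberTheory.GaloisRepresentations
open Literature.NumberTheory.GaloisRepresentations.DiscreteGaloisModule (SelmerStructure)
open Literature.NumberTheory.GaloisCohomology
open Summit.BirchSwinnertonDyer.Rank1Residual.X11b.KummerPT
open Summit.BirchSwinnertonDyer.Rank1Residual.X11b.FiniteDuality
open Summit.BirchSwinnertonDyer.Rank1Residual.X11b.Relaxation
open Summit.BirchSwinnertonDyer.Rank1Residual.X11b.LocBridge Summit.BirchSwinnertonDyer.Rank1Residual.X11b.Levels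
open Summit.BirchSwinnertonDyer.Rank1Residual.X11b.AcSelmer
open scoped ContRepresentation

namespace Summit.BirchSwinnertonDyer.BirchSwinnertonDyer.Theorems.GenusExact.AuxiliaryClass

open Summit.BirchSwinnertonDyer.BirchSwinnertonDyer.Theorems.GenusKolyKramer (finite_galoisCohomology_toLocal)

variable {K : Type} [Field K] [NumberField K] (W : WeierstrassCurve K) [W.IsElliptic]

/-! ## §1 Local facts at every place -/

section Local

variable (n : ℕ) [NeZero n]
variable (e : W.geomTorsion n → W.geomTorsion n → AlgebraicClosure K)
  (hμ : ∀ S T, e S T ^ n = 1)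
  (hadd₁ : ∀ S₁ S₂ T, e (S₁ + S₂) T = e S₁ T * e S₂ T)
  (hadd₂ : ∀ S T₁ T₂, e S (T₁ + T₂) = e S T₁ * e S T₂)
  (hgal : ∀ (σ : absoluteGaloisGroup K) (S T : W.geomTorsion n), σ • e S T = e (σ • S) (σ • T))
  (halt : ∀ T, e T T = 1) (hnondeg : ∀ T, (∀ S, e S T = 1) → T = 0)
  (inv : LocalInvariants K n)

include hnondeg halt in
/-- **Left adjoint of `inv_w(· ∪ₑ ·)` bijective at an infinite place** with `inv_w` injective (left kernel
`eq_zero_of_forall_weilCupProduct_eq_zero_inl` + counting). [cite: MilneADT2006, Ch. I, Thm. 2.13] -/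
theorem invWeilPairing_bijective_inl (w : InfinitePlace K) (hinv : Injective (inv (Sum.inl w))) :
    Bijective (invWeilPairing W n e hμ hadd₁ hadd₂ hgal inv (Sum.inl w)) := by
  haveI := finite_galoisCohomology_toLocal W n (Sum.inl w)
  have hA := nsmul_galoisCohomology_toLocal_eq_zero W n (Sum.inl w)
  haveI := finite_addMonoidHom_zmod (galoisCohomology ((W.torsionGaloisModule n).toLocal (Sum.inl w)) 1) n
  have hinj : Injective (invWeilPairing W n e hμ hadd₁ hadd₂ hgal inv (Sum.inl w)) := by
    intro x x' h
    rw [← sub_eq_zero]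
    refine eq_zero_of_forall_weilCupProduct_eq_zero_inl W n e hμ hadd₁ hadd₂ w hgal halt hnondeg _ fun y ↦ ?_
    have h1 : invWeilPairing W n e hμ hadd₁ hadd₂ hgal inv (Sum.inl w) (x - x') y = 0 := by
      rw [map_sub, h, sub_self, AddMonoidHom.zero_apply]
    rw [invWeilPairing_apply] at h1
    exact hinv (h1.trans (map_zero _).symm)
  exact hinj.bijective_of_nat_card_le (Nat.card_addMonoidHom_zmod hA).le

omit [W.IsElliptic] in
/-- At a COMPLEX place the pairing is (trivially) perfect: `H¹(K_w, E[n]) = 0`. [folklore] -/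
theorem invWeilPairing_bijective_inl_of_isComplex (w : InfinitePlace K) (hw : w.IsComplex) :
    Bijective (invWeilPairing W n e hμ hadd₁ hadd₂ hgal inv (Sum.inl w)) := by
  haveI := subsingleton_galoisCohomology_toLocal_inl_of_isComplex (W.torsionGaloisModule (n : ℤ)) hw
  refine ⟨fun x y _ ↦ Subsingleton.elim x y, fun f ↦ ⟨0, ?_⟩⟩
  ext y
  rw [Subsingleton.elim y 0, map_zero, map_zero]

include hnondeg halt in
/-- **The local pairing is perfect at every place of `T`** when `inv` is injective at the finite places and at the real places
(`IsPerfect` + `hreal`; complex places are trivial). [cite: MilneADT2006, Ch. I, Cor. 2.3 and Thm. 2.13] -/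
theorem invWeilPairing_bijective_place (hperf : inv.IsPerfect)
    (hreal : ∀ w : InfinitePlace K, w.IsReal → Injective (inv (Sum.inl w))) (v : Place K) :
    Bijective (invWeilPairing W n e hμ hadd₁ hadd₂ hgal inv v) := by
  cases v with
  | inl w =>
    by_cases hw : w.IsComplex
    · exact invWeilPairing_bijective_inl_of_isComplex W n e hμ hadd₁ hadd₂ hgal inv w hw
    · exact invWeilPairing_bijective_inl W n e hμ hadd₁ hadd₂ hgal halt hnondeg inv w
        (hreal w (InfinitePlace.not_isComplex_iff_isReal.mp hw))
  | inr v => exact invWeilPairing_bijective W n e hμ hadd₁ hadd₂ hgal hnondeg inv v (hperf v).1.1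

end Local

/-! ## §2 The maximal-isotropic count over a finite set of places of any kind -/

section Count

variable (p k : ℕ) [Fact p.Prime] [Finite (W.geomTorsion ((p ^ k : ℕ) : ℤ))]
variable (e : W.geomTorsion ((p ^ k : ℕ) : ℤ) → W.geomTorsion ((p ^ k : ℕ) : ℤ) → AlgebraicClosure K)
  (hμ : ∀ S T, e S T ^ (p ^ k) = 1)
  (hadd₁ : ∀ S₁ S₂ T, e (S₁ + S₂) T = e S₁ T * e S₂ T)
  (hadd₂ : ∀ S T₁ T₂, e S (T₁ + T₂) = e S T₁ * e S T₂)
  (hgal : ∀ (σ : absoluteGaloisGroup K) (S T : W.geomTorsion ((p ^ k : ℕ) : ℤ)),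
    σ • e S T = e (σ • S) (σ • T))
  (halt : ∀ T, e T T = 1) (hnondeg : ∀ T, (∀ S, e S T = 1) → T = 0)

include halt hnondeg in
/-- **`G = loc_T(H¹_{𝓛, ⊤ on T}(K, E[p^k]))` is its own (left) annihilator**, `T` ANY finite set of places of any number field
(families with `IsPerfect`, `SumLocalTermEqZero`, `SelmerComplement`, Tate's count at finite places, injective at the real places).
[cite: McCallumLMS1991, §2 proof of Prop. 2.1] [cite: MilneADT2006, Ch. I, Thm. 4.10(b)] -/
theorem annLeft_map_kummerOutside_eq_places
    {inv : LocalInvariants K (p ^ k)} (hperf : inv.IsPerfect) (hsum : inv.SumLocalTermEqZero)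
    (hcompl : inv.SelmerComplement)
    (hEuler : ∀ v : HeightOneSpectrum (𝓞 K),
      Nat.card (galoisCohomology ((W.torsionGaloisModule ((p ^ k : ℕ) : ℤ)).toLocal (Sum.inr v)) 1) =
        (Nat.card (nsmulAddMonoidHom (p ^ k) :
            (W.baseChange (v.adicCompletion K)).toAffine.Point →+ _).ker *
          Nat.card (v.adicCompletionIntegers K ⧸
            Ideal.span {((p ^ k : ℕ) : v.adicCompletionIntegers K)})) ^ 2)
    (hreal : ∀ w : InfinitePlace K, w.IsReal → Injective (inv (Sum.inl w)))
    (T : Finset (Place K))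
    (loc : galoisCohomology (W.torsionGaloisModule ((p ^ k : ℕ) : ℤ)) 1 →+
      (∀ u : ↥T, galoisCohomology ((W.torsionGaloisModule ((p ^ k : ℕ) : ℤ)).toLocal (u : Place K)) 1))
    (hloc : ∀ c u, loc c u = galoisCohomology.localization (W.torsionGaloisModule ((p ^ k : ℕ) : ℤ)) (u : Place K) 1 c)
    (bP : (∀ u : ↥T, galoisCohomology ((W.torsionGaloisModule ((p ^ k : ℕ) : ℤ)).toLocal (u : Place K)) 1) →+
          (∀ u : ↥T, galoisCohomology ((W.torsionGaloisModule ((p ^ k : ℕ) : ℤ)).toLocal (u : Place K)) 1) →+ ZMod (p ^ k))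
    (hbP : ∀ x y, bP x y = ∑ u : ↥T, invWeilPairing W (p ^ k) e hμ hadd₁ hadd₂ hgal inv (u : Place K) (x u) (y u)) :
    annLeft bP ((kummerOutside W (p ^ k) T).map loc) = (kummerOutside W (p ^ k) T).map loc := by
  classical
  have hsumT : ∀ F : Place K → ZMod (p ^ k), ∑ u : ↥T, F (u : Place K) = ∑ v ∈ T, F v :=
    fun F ↦ Finset.sum_coe_sort T F
  ext t
  constructor
  · intro ht
    rw [mem_annLeft_iff] at ht
    -- the test family, extended by zero to all places
    obtain ⟨tfull, htfull⟩ : ∃ tfull : ∀ v : Place K,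
        galoisCohomology ((W.torsionGaloisModule ((p ^ k : ℕ) : ℤ)).toLocal v) 1, ∀ u : ↥T, tfull (u : Place K) = t u :=
      ⟨fun v ↦ if h : v ∈ T then t ⟨v, h⟩ else 0, fun u ↦ by simp only [dif_pos u.2]⟩
    obtain ⟨x, hx, hxt⟩ := exists_mem_kummerOutside_localization_eq_real W p k e hμ hadd₁ hadd₂ hgal halt hnondeg
      hperf hcompl hEuler hreal T tfull (fun c hc ↦ by
        have h := ht (loc c) ⟨c, hc, rfl⟩
        rw [hbP] at h
        rw [← hsumT]
        refine Eq.trans (Finset.sum_congr rfl fun u _ ↦ ?_) h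
        rw [htfull, hloc])
    refine ⟨x, hx, ?_⟩
    funext u
    rw [hloc, hxt _ u.2, htfull]
  · rintro ⟨c, hc, rfl⟩
    rw [mem_annLeft_iff]
    rintro g ⟨c', hc', rfl⟩
    rw [hbP]
    have h := sum_invWeilPairing_localization_eq_zero_of_mem_kummerOutside W (p ^ k) e hμ hadd₁ hadd₂ hgal halt
      inv hsum T hc hc'
    rw [← hsumT] at h
    refine Eq.trans (Finset.sum_congr rfl fun u _ ↦ ?_) h
    rw [hloc, hloc]

include e hμ hadd₁ hadd₂ hgal halt hnondeg in
/-- **McCallum's «maximal isotropic» count over any finite set of places of any number field**: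
`#loc_T(H¹_{𝓛, ⊤ on T}(K, E[p^k]))² = ∏_{v∈T} #H¹(K_v, E[p^k])`. [cite: McCallumLMS1991, §2 proof of Prop. 2.1]
[cite: MilneADT2006, Ch. I, Cor. 2.3, Thm. 2.13 and Thm. 4.10(b)] -/
theorem natCard_map_kummerOutside_sq_places
    {inv : LocalInvariants K (p ^ k)} (hperf : inv.IsPerfect) (hsum : inv.SumLocalTermEqZero)
    (hcompl : inv.SelmerComplement)
    (hEuler : ∀ v : HeightOneSpectrum (𝓞 K),
      Nat.card (galoisCohomology ((W.torsionGaloisModule ((p ^ k : ℕ) : ℤ)).toLocal (Sum.inr v)) 1) =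
        (Nat.card (nsmulAddMonoidHom (p ^ k) :
            (W.baseChange (v.adicCompletion K)).toAffine.Point →+ _).ker *
          Nat.card (v.adicCompletionIntegers K ⧸
            Ideal.span {((p ^ k : ℕ) : v.adicCompletionIntegers K)})) ^ 2)
    (hreal : ∀ w : InfinitePlace K, w.IsReal → Injective (inv (Sum.inl w)))
    (T : Finset (Place K))
    (loc : galoisCohomology (W.torsionGaloisModule ((p ^ k : ℕ) : ℤ)) 1 →+
      (∀ u : ↥T, galoisCohomology ((W.torsionGaloisModule ((p ^ k : ℕ) : ℤ)).toLocal (u : Place K)) 1))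
    (hloc : ∀ c u, loc c u = galoisCohomology.localization (W.torsionGaloisModule ((p ^ k : ℕ) : ℤ)) (u : Place K) 1 c) :
    Nat.card ((kummerOutside W (p ^ k) T).map loc) ^ 2 =
      ∏ v ∈ T, Nat.card (galoisCohomology ((W.torsionGaloisModule ((p ^ k : ℕ) : ℤ)).toLocal v) 1) := by
  classical
  haveI hfin : ∀ u : ↥T, Finite (galoisCohomology ((W.torsionGaloisModule ((p ^ k : ℕ) : ℤ)).toLocal (u : Place K)) 1) :=
    fun u ↦ finite_galoisCohomology_toLocal W (p ^ k) u
  have hA : ∀ (u : ↥T) (x : galoisCohomology ((W.torsionGaloisModule ((p ^ k : ℕ) : ℤ)).toLocal (u : Place K)) 1),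
      (p ^ k) • x = 0 := fun u x ↦ nsmul_galoisCohomology_toLocal_eq_zero W (p ^ k) _ x
  obtain ⟨bP, hbP⟩ := exists_piSum (fun u : ↥T ↦ invWeilPairing W (p ^ k) e hμ hadd₁ hadd₂ hgal inv (u : Place K))
  have hbij : Bijective bP := bijective_piSum hA _
    (fun u ↦ (invWeilPairing_bijective_place W (p ^ k) e hμ hadd₁ hadd₂ hgal halt hnondeg inv hperf hreal (u : Place K)).1)
    bP hbP
  haveI : Finite (∀ u : ↥T, galoisCohomology ((W.torsionGaloisModule ((p ^ k : ℕ) : ℤ)).toLocal (u : Place K)) 1) :=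
    Pi.finite
  have hA' : ∀ x : (∀ u : ↥T, galoisCohomology ((W.torsionGaloisModule ((p ^ k : ℕ) : ℤ)).toLocal (u : Place K)) 1),
      (p ^ k) • x = 0 := fun x ↦ funext fun u ↦ by rw [Pi.smul_apply, Pi.zero_apply, hA u (x u)]
  have hcount := natCard_annLeft_mul hA' bP hbij ((kummerOutside W (p ^ k) T).map loc)
  rw [annLeft_map_kummerOutside_eq_places W p k e hμ hadd₁ hadd₂ hgal halt hnondeg hperf hsum hcompl hEuler hreal T loc hloc
    bP hbP] at hcount
  rw [sq, hcount, Nat.card_pi, Finset.prod_coe_sort T fun v ↦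
    Nat.card (galoisCohomology ((W.torsionGaloisModule ((p ^ k : ℕ) : ℤ)).toLocal v) 1)]

end Count

end Summit.BirchSwinnertonDyer.BirchSwinnertonDyer.Theorems.GenusExact.AuxiliaryClass

end
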